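import Summits.QuantumFields.YangMills.Theorems.BalabanUVNodesN27LedgerJoin

/-!
# BalabanUVNodes ∕ N27 spine-record join, VII — THE ∃-PACKAGE FORM UNDER THE PREFIX (the shape a record predicate delivers): per
# tuned sequence `g₀` and per string `os`, SOME class index type, SOME ledger data, SOME carriers with N20 · N21 · budget · E1∕E2 ·
# `PolyLipGrowth` · dag-n19-b's `LedgerAt` AT THE DATUM'S CLAMPED RUNS ⇒ `T4ApexHybrid.HybridNE7Under D Hβ`
# (cell `pub-ymgap`, HUMAN RULING D-0062 Track A, seat `pub-ymgap-dag-n27-a` g3; `--supports stmt-QuantumFields-19182`, count-neutral)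

WHY.  The datum-level joins of files I∕III∕V∕VI take the K5 ∕ ledger carriers as FUNCTIONS of `(g₀, os)` into ONE class index type `σ`
(readable named hypotheses).  A spine record predicate — the dagwriter's `SpineCarriers` bundle `S` with the index type a FIELD `S.ι`, or
dag-n20-a's tower reading `ι := HIndex.Idx (skelFam Sd.T Sd.p₀)` — delivers the carriers per `(g₀, os)` as an EXISTENTIAL package whose
index type varies with the string, exactly as binder B5's own currency does (`StringwiseHybridNE7`: `∀ os, ∃ l₀ vol K₀, … ∃ ι _ T A B …`).
THIS module states the N27 join in that currency: under the targets' prefix, for every tuned `g₀` and every string `os`, `∃ σ _ L l₀ vol K₀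
T Bad A B shA shB W Wsh, …` with the two runs' coupling tables WRITTEN OUT as the datum's clamped runs
`K ↦ extd (prefixOf (runFlow D g₀ (K₀ + K)) (K₀ + K))` (§1; no defining hypothesis, `K₀` is bound in the package) or as the raw runs
`K ↦ runFlow D g₀ (K₀ + K)` (§2).  With it the rev-1 glue «record predicate + children → `YMDAG.B5 D`» is: per `(g₀, os)` take the record's
`S`, read N20∕N21∕budget∕E1-E2∕Link off the children BY NAME, pack, cite §1 — no choice functions, no uniformity of `σ` across strings.
g0's `BalabanUVNodesSpineGivenEndpointN27.hybridNE7Under_of_spineNodes` is the same currency with N19 ∧ U4′ OPAQUE (`Core ∧ Summable δ` in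
the package); here N19 is REPLACED by its in-edges + `LedgerAt` through `core_summable_of_ledgerAt` (file VI §1).

WHAT IS KERNEL-CHECKED ([bookkeeping] ∕ [folklore]; 0 `def`, 0 `sorry`).
* §1 `hybridNE7Under_of_ledgerPackage_tuned` — TOP LEVEL by name: N16 `LocalRate` + liaison, N18 `NE5`, N22 `NE9 ∧ FadingMemory`,
  `LipBackground`, `hWin : Window γᵤ ⊆ Wset`, letter signs; UNDER THE PREFIX: `hU2` (edge N17 → N27, `U2Output D g₀ Cd θc`) and
  **`hPkg`** = per string the ∃-package (`0 < l₀`, `0 < vol`, N20, N21, `W + Wsh < 1`, E1∕E2 vs `schemeZ (D.scheme g₀) os (K₀+K)`,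
  `PolyLipGrowth` of the clamped tables, `LedgerAt L …` on the shell-free cores at the clamped tables); box AND windows READ OFF `Tuned`
  ⇒ `T4ApexHybrid.HybridNE7Under D Hβ`.
* §2 `hybridNE7Under_of_ledgerPackage` — the same at the RAW run tables, the two window memberships asked inside the package, box from
  `Tuned`, no `hWin`.
* §3 `ledgerPackage_tuned_of_functions` — file VI §3's function-carrier antecedents (`hg`-pinned tables, `hK5`, `hG`, `hLedger`) PRODUCE §1's
  package under the prefix: the named-hypotheses form is a special case of the package form (VI §3 = §3 ≫ §1 term for term:
  `hybridNE7Under_of_ledgerPackage_tuned D hγu hWin … hU2 (ledgerPackage_tuned_of_functions D hg hK5 hG hLedger)` — not re-declared,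
  the gate's dedup lint identifies it with the landed VI §3).

HONEST FRAMING.  COMPOSITE-node bookkeeping with the children's children as hypotheses: NE3∕NE4's out-edge∕NE5∕NE9∕NE7b∕NE7c are HYPOTHESIS
SHAPES (none printed for Bałaban's d = 4 procedure, none proved), `LedgerAt` is NODE O content typed by dag-n19-b; nothing of Bałaban's
objects is instantiated; NO node is discharged; (B) and `Hβ` are antecedents, used, never refuted; one fixed finite four-torus — NOT ℝ⁴,
NOT infinite volume, NOT OS axioms, NOT a mass gap, NOT Clay.  Typed 28∕28; the discharged count is not touched by this file.  No decl
below carries a cite tag.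
-/

open Finset MeasureTheory

namespace Summit.QuantumFields.YangMills.Theorems.BalabanUVNodesN27SpineRecord

open Literature.MathematicalPhysics.QuantumFieldTheory.Balaban1983to89
open Literature.MathematicalPhysics.QuantumFieldTheory.Balaban1983to89.T4Continuum
open T4OutputRate T4RecentScale T4GoodClassBudget T4CauchySum T4TowerRateComposition T4TowerRateDischarge T4TermwiseBudget
open T4WeightBudget (RelWeightBound)
open T4IndicatorShell (ShellWeightBound)
open T4MatchingAssembly (StringHybridNE7)
open T4EtaRateMin (Readings LocalRate)
open T4RateLiaison (GaugeDominated)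
open T4ContinuumYM4Torus (ForSmallCouplings)
open T4FlagMemory (extd)
open FlowStep (prefixOf)
open Summit.QuantumFields.BalabanUV.T4Continuum.Spine
open Summit.QuantumFields.BalabanUV.T4Continuum.Spine.NE4 (U2Output runFlow)
open Summit.QuantumFields.YangMills.BalabanUVNodes.N19SizeWindow (LedgerData LedgerAt core_summable_of_ledgerAt)

section Datum

variable {F : T4Family} {G : Type*} [GaugeGroup G] [MeasurableSpace G] [HaarData G]
  {C : Carriers} {ι X : Type} [MeasurableSpace ι]
  {R : Readings ι X} {Wset : Set (ℕ → ℝ)} {EA : Functional C C.BgA} {EB : Functional C C.BgB}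
  {κ θ₅ C₅ C₉ ω C₃ θ₃ P γu : ℝ} {q : ℕ} {Λm : ℕ → ℕ → ℝ} {CU : (ℕ → ℝ) → ℕ → ℝ}
  {uA : ℕ → ι → C.BgA} {uB : ℕ → ι → C.BgB}

/-! ## §1 The ∃-package at the CLAMPED run tables: box AND windows read off `Tuned` -/

/-- **N27 = B5 AT THE DATUM FROM A PER-STRING ∃-PACKAGE, LINK BY NAME, CLAMPED TABLES** (any finite-`ε` datum `D`, any β-binder `Hβ`).
TOP LEVEL, BY NAME: N16 in the minimal currency `hloc : LocalRate R C₃ θ₃` + liaison `hgd`, N18 `h18 : NE5 EA EB Wset κ θ₅ C₅`, N22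
`h22 : NE9 EA Wset κ Λm ∧ FadingMemory C₉ ω Λm`, node U3's `hUL : LipBackground EA Wset κ CU`, `hWin : Window γᵤ ⊆ Wset` (`γᵤ > 0`),
letter signs.  UNDER THE TARGETS' PREFIX: `hU2` — the edge N17 → N27, `Spine.NE4.U2Output D g₀ Cd θc`; **`hPkg`** — for every string
`os` an ∃-PACKAGE: a class index type `σ` with decidable equality, ledger data `L : LedgerData C ι σ`, `l₀, vol > 0`, an offset `K₀`,
classes `T`, bad classes `Bad`, term weights `A, B`, shells `shA, shB`, weights `W, Wsh`, such that N20 `RelWeightBound`, N21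
`ShellWeightBound`, `W + Wsh < 1`, the E1∕E2 dictionary against `T4GenFunBounds.schemeZ (D.scheme g₀) os (K₀ + K)` ∕ `(K₀ + K + 1)`,
`PolyLipGrowth CU g P q` and dag-n19-b's `LedgerAt L l₀ vol T Bad (A − shA) (B − shB) R EA EB κ g uA uB ω θc θ₅ θ₃` hold AT THE CLAMPED
RUN TABLES `g K := extd (prefixOf (runFlow D g₀ (K₀ + K)) (K₀ + K))`.  Inside the proof the `γ`-threshold is shrunk to `min γ₀ γᵤ`; the
box `0 < g K i ≤ γ` (`i ≤ K`) and both window memberships follow from `D.Tuned γ g g₀`; `hU2` transfers to the clamped tables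
(`injectedRate_clamped`); then file VI §1 `stringHybridNE7_of_ledgerAt`.  CONCLUSION: `T4ApexHybrid.HybridNE7Under D Hβ`.  CONDITIONAL on
every binder; nothing of Bałaban's instantiated; NOT a discharge. [bookkeeping] [folklore] -/
theorem hybridNE7Under_of_ledgerPackage_tuned (D : FiniteEpsData F G) {Hβ : Prop} {Cd θc : ℝ}
    (hγu : 0 < γu) (hWin : Window γu ⊆ Wset)
    (hloc : LocalRate R C₃ θ₃) (hC₃ : 0 ≤ C₃) (hθ₃ : 0 ≤ θ₃) (hθ₃1 : θ₃ < 1) (hgd : GaugeDominated R uA uB)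
    (h18 : NE5 EA EB Wset κ θ₅ C₅) (hθ₅ : 0 ≤ θ₅) (hC₅ : 0 ≤ C₅)
    (h22 : NE9 EA Wset κ Λm ∧ FadingMemory C₉ ω Λm) (hω : 0 ≤ ω)
    (hUL : LipBackground EA Wset κ CU) (hP : 0 ≤ P) (hCd : 0 ≤ Cd) (hθc : 0 ≤ θc)
    (hU2 : D.UnderHypotheses Hβ fun g₀ => U2Output D g₀ Cd θc)
    (hPkg : D.UnderHypotheses Hβ fun g₀ => ∀ os : List (ULoop F),
      ∃ (σ : Type) (_ : DecidableEq σ) (L : LedgerData C ι σ) (l₀ vol : ℝ) (K₀ : ℕ) (T : ℕ → Finset σ)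
        (Bad : ℕ → ℝ → Finset σ) (A B shA shB : ℕ → ℝ → σ → ℝ) (W Wsh : ℕ → ℝ),
        0 < l₀ ∧ 0 < vol ∧ RelWeightBound l₀ T A B Bad W ∧ ShellWeightBound l₀ T A B shA shB Wsh ∧ (∀ K, W K + Wsh K < 1) ∧
        (∀ (K : ℕ) (t : ℝ), |t| ≤ l₀ → T4GenFunBounds.schemeZ (D.scheme g₀) os (K₀ + K) t = ∑ τ ∈ T K, A K t τ) ∧
        (∀ (K : ℕ) (t : ℝ), |t| ≤ l₀ → T4GenFunBounds.schemeZ (D.scheme g₀) os (K₀ + K + 1) t = ∑ τ ∈ T K, B K t τ) ∧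
        PolyLipGrowth CU (fun K => extd (prefixOf (runFlow D g₀ (K₀ + K)) (K₀ + K))) P q ∧
        LedgerAt L l₀ vol T Bad (fun K t τ => A K t τ - shA K t τ) (fun K t τ => B K t τ - shB K t τ) R EA EB κ
          (fun K => extd (prefixOf (runFlow D g₀ (K₀ + K)) (K₀ + K))) uA uB ω θc θ₅ θ₃) :
    T4ApexHybrid.HybridNE7Under D Hβ := by
  intro hB hβ
  have H1 : ForSmallCouplings D _ := hU2 hB hβ
  have H2 : ForSmallCouplings D _ := hPkg hB hβ
  obtain ⟨γ₀, hγ₀, Hγ⟩ := H1.and H2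
  -- shrink the `γ`-threshold to `≤ γᵤ`, so that the tuned runs' window `Window γ` sits inside `Wset`
  refine ⟨min γ₀ γu, lt_min hγ₀ hγu, fun γ hγ hγle => ?_⟩
  obtain ⟨g₁, hg₁, Hg⟩ := Hγ γ hγ (hγle.trans (min_le_left _ _))
  refine ⟨g₁, hg₁, fun gIR hgIR hgIRle g₀ ht os => ?_⟩
  obtain ⟨hu2, hpkg⟩ := Hg gIR hgIR hgIRle g₀ ht
  obtain ⟨σ, _, L, l₀, vol, K₀, T, Bad, A, B, shA, shB, W, Wsh, hl₀, hvol, h20, h21, hlt, hE1, hE2, hG, hL⟩ := hpkg os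
  have hWγ : Window γ ⊆ Wset := fun h hh => hWin fun i => ⟨(hh i).1, (hh i).2.trans (hγle.trans (min_le_right _ _))⟩
  -- the runs stay in `]0, γ]` (Tuned), so the clamped tables are in the window and in the box
  have hrun : ∀ K i, i ≤ K₀ + K → 0 < runFlow D g₀ (K₀ + K) i ∧ runFlow D g₀ (K₀ + K) i ≤ γ := fun K i hi =>
    (ht (K₀ + K)).1 i hi
  have hgA : ∀ K, extd (prefixOf (runFlow D g₀ (K₀ + K)) (K₀ + K)) ∈ Wset := fun K =>
    hWγ (extd_prefixOf_mem_window (hrun K))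
  have hgB : ∀ K, (fun i => extd (prefixOf (runFlow D g₀ (K₀ + (K + 1))) (K₀ + (K + 1))) (i + 1)) ∈ Wset := fun K =>
    hWγ (extd_prefixOf_succ_mem_window (hrun (K + 1)))
  have hbox : ∀ K i, i ≤ K → 0 < extd (prefixOf (runFlow D g₀ (K₀ + K)) (K₀ + K)) i ∧
      extd (prefixOf (runFlow D g₀ (K₀ + K)) (K₀ + K)) i ≤ γ := fun K i hi => by
    rw [T4FlagMemoryTwoRun.extd_prefixOf (show i ≤ K₀ + K by omega)]
    exact hrun K i (by omega)
  have hinj : InjectedRate Cd 0 θc fun K j => T4CouplingMatching.disc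
      (extd (prefixOf (runFlow D g₀ (K₀ + K)) (K₀ + K))) (extd (prefixOf (runFlow D g₀ (K₀ + (K + 1))) (K₀ + (K + 1)))) j :=
    injectedRate_clamped D hu2 K₀ (g := fun K => extd (prefixOf (runFlow D g₀ (K₀ + K)) (K₀ + K))) fun _ => rfl
  exact ⟨l₀, vol, K₀, hl₀, hvol,
    stringHybridNE7_of_ledgerAt (g := fun K => extd (prefixOf (runFlow D g₀ (K₀ + K)) (K₀ + K))) (D.scheme g₀) os K₀ h20 h21
      hlt hE1 hE2 hL h22 hω hUL hG hP h18 hθ₅ hC₅ hloc hC₃ hθ₃ hθ₃1 hgd hinj hCd hθc hbox hgA hgB⟩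

/-! ## §2 The ∃-package at the RAW run tables: windows inside the package, box read off `Tuned` -/

/-- **N27 = B5 AT THE DATUM FROM A PER-STRING ∃-PACKAGE, LINK BY NAME, RAW TABLES.**  As §1 EXCEPT: the two runs' coupling tables are
the raw runs `g K := Spine.NE4.runFlow D g₀ (K₀ + K)` (run B re-indexed `i ↦ runFlow D g₀ (K₀ + K + 1) (i + 1)`), and the package carries the
two window memberships `g K ∈ Wset`, `(i ↦ g (K+1) (i+1)) ∈ Wset` itself (the construction's tail beyond the run length is the instantiator's
business — dag-n19-b's point (iv)); no `hWin`, the `γ`-threshold is not shrunk; the box is read off `Tuned`; `hU2` re-based by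
`injectedRate_shift`.  CONCLUSION: `T4ApexHybrid.HybridNE7Under D Hβ`.  CONDITIONAL on every binder; NOT a discharge. [bookkeeping] [folklore] -/
theorem hybridNE7Under_of_ledgerPackage (D : FiniteEpsData F G) {Hβ : Prop} {Cd θc : ℝ}
    (hloc : LocalRate R C₃ θ₃) (hC₃ : 0 ≤ C₃) (hθ₃ : 0 ≤ θ₃) (hθ₃1 : θ₃ < 1) (hgd : GaugeDominated R uA uB)
    (h18 : NE5 EA EB Wset κ θ₅ C₅) (hθ₅ : 0 ≤ θ₅) (hC₅ : 0 ≤ C₅)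
    (h22 : NE9 EA Wset κ Λm ∧ FadingMemory C₉ ω Λm) (hω : 0 ≤ ω)
    (hUL : LipBackground EA Wset κ CU) (hP : 0 ≤ P) (hCd : 0 ≤ Cd) (hθc : 0 ≤ θc)
    (hU2 : D.UnderHypotheses Hβ fun g₀ => U2Output D g₀ Cd θc)
    (hPkg : D.UnderHypotheses Hβ fun g₀ => ∀ os : List (ULoop F),
      ∃ (σ : Type) (_ : DecidableEq σ) (L : LedgerData C ι σ) (l₀ vol : ℝ) (K₀ : ℕ) (T : ℕ → Finset σ)
        (Bad : ℕ → ℝ → Finset σ) (A B shA shB : ℕ → ℝ → σ → ℝ) (W Wsh : ℕ → ℝ),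
        0 < l₀ ∧ 0 < vol ∧ RelWeightBound l₀ T A B Bad W ∧ ShellWeightBound l₀ T A B shA shB Wsh ∧ (∀ K, W K + Wsh K < 1) ∧
        (∀ (K : ℕ) (t : ℝ), |t| ≤ l₀ → T4GenFunBounds.schemeZ (D.scheme g₀) os (K₀ + K) t = ∑ τ ∈ T K, A K t τ) ∧
        (∀ (K : ℕ) (t : ℝ), |t| ≤ l₀ → T4GenFunBounds.schemeZ (D.scheme g₀) os (K₀ + K + 1) t = ∑ τ ∈ T K, B K t τ) ∧
        PolyLipGrowth CU (fun K => runFlow D g₀ (K₀ + K)) P q ∧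
        (∀ K, runFlow D g₀ (K₀ + K) ∈ Wset) ∧ (∀ K, (fun i => runFlow D g₀ (K₀ + (K + 1)) (i + 1)) ∈ Wset) ∧
        LedgerAt L l₀ vol T Bad (fun K t τ => A K t τ - shA K t τ) (fun K t τ => B K t τ - shB K t τ) R EA EB κ
          (fun K => runFlow D g₀ (K₀ + K)) uA uB ω θc θ₅ θ₃) :
    T4ApexHybrid.HybridNE7Under D Hβ := by
  intro hB hβ
  have H1 : ForSmallCouplings D _ := hU2 hB hβ
  have H2 : ForSmallCouplings D _ := hPkg hB hβ
  obtain ⟨γ₀, hγ₀, Hγ⟩ := H1.and H2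
  refine ⟨γ₀, hγ₀, fun γ hγ hγle => ?_⟩
  obtain ⟨g₁, hg₁, Hg⟩ := Hγ γ hγ hγle
  refine ⟨g₁, hg₁, fun gIR hgIR hgIRle g₀ ht os => ?_⟩
  obtain ⟨hu2, hpkg⟩ := Hg gIR hgIR hgIRle g₀ ht
  obtain ⟨σ, _, L, l₀, vol, K₀, T, Bad, A, B, shA, shB, W, Wsh, hl₀, hvol, h20, h21, hlt, hE1, hE2, hG, hgA, hgB, hL⟩ :=
    hpkg os
  -- the box of both runs' tables, READ OFF `Tuned` at the run `K₀ + K`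
  have hbox : ∀ K i, i ≤ K → 0 < runFlow D g₀ (K₀ + K) i ∧ runFlow D g₀ (K₀ + K) i ≤ γ := fun K i hi =>
    (ht (K₀ + K)).1 i (hi.trans (Nat.le_add_left K K₀))
  -- N17's out-edge re-based at `K₀`
  have hinj : InjectedRate Cd 0 θc fun K j =>
      T4CouplingMatching.disc (runFlow D g₀ (K₀ + K)) (runFlow D g₀ (K₀ + (K + 1))) j :=
    injectedRate_shift hu2 K₀
  exact ⟨l₀, vol, K₀, hl₀, hvol,
    stringHybridNE7_of_ledgerAt (g := fun K => runFlow D g₀ (K₀ + K)) (D.scheme g₀) os K₀ h20 h21 hlt hE1 hE2 hL h22 hω hUL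
      hG hP h18 hθ₅ hC₅ hloc hC₃ hθ₃ hθ₃1 hgd hinj hCd hθc hbox hgA hgB⟩

/-! ## §3 The named-hypotheses form (file VI §3) is a special case of the package form -/

variable {σ : Type} [DecidableEq σ]
  {L : (ℕ → ℝ) → List (ULoop F) → LedgerData C ι σ}
  {l₀ vol : (ℕ → ℝ) → List (ULoop F) → ℝ} {K₀ : (ℕ → ℝ) → List (ULoop F) → ℕ}
  {g : (ℕ → ℝ) → List (ULoop F) → ℕ → ℕ → ℝ}
  {T : (ℕ → ℝ) → List (ULoop F) → ℕ → Finset σ} {Bad : (ℕ → ℝ) → List (ULoop F) → ℕ → ℝ → Finset σ}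
  {A B shA shB : (ℕ → ℝ) → List (ULoop F) → ℕ → ℝ → σ → ℝ} {W Wsh : (ℕ → ℝ) → List (ULoop F) → ℕ → ℝ}

/-- **FUNCTION CARRIERS PRODUCE THE PACKAGE.**  File VI §3's antecedents under the prefix — the table map `g` pinned by `hg` to the clamped
runs, `hK5` (N20 · N21 · budget · E1∕E2), `hG` (`PolyLipGrowth`), `hLedger` (`LedgerAt (L g₀ os) …`) — yield §1's ∃-package under the same
prefix (thresholds conjoined by `ForSmallCouplings.and`; the witnesses are the functions' values at `(g₀, os)`, the tables rewritten by `hg`).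
[bookkeeping] [folklore] -/
theorem ledgerPackage_tuned_of_functions (D : FiniteEpsData F G) {Hβ : Prop} {θc : ℝ}
    (hg : ∀ g₀ os K, g g₀ os K = extd (prefixOf (runFlow D g₀ (K₀ g₀ os + K)) (K₀ g₀ os + K)))
    (hK5 : D.UnderHypotheses Hβ fun g₀ => ∀ os : List (ULoop F),
      0 < l₀ g₀ os ∧ 0 < vol g₀ os ∧
        RelWeightBound (l₀ g₀ os) (T g₀ os) (A g₀ os) (B g₀ os) (Bad g₀ os) (W g₀ os) ∧
        ShellWeightBound (l₀ g₀ os) (T g₀ os) (A g₀ os) (B g₀ os) (shA g₀ os) (shB g₀ os) (Wsh g₀ os) ∧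
        (∀ K, W g₀ os K + Wsh g₀ os K < 1) ∧
        (∀ (K : ℕ) (t : ℝ), |t| ≤ l₀ g₀ os →
          T4GenFunBounds.schemeZ (D.scheme g₀) os (K₀ g₀ os + K) t = ∑ τ ∈ T g₀ os K, A g₀ os K t τ) ∧
        (∀ (K : ℕ) (t : ℝ), |t| ≤ l₀ g₀ os →
          T4GenFunBounds.schemeZ (D.scheme g₀) os (K₀ g₀ os + K + 1) t = ∑ τ ∈ T g₀ os K, B g₀ os K t τ))
    (hG : D.UnderHypotheses Hβ fun g₀ => ∀ os : List (ULoop F), PolyLipGrowth CU (g g₀ os) P q)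
    (hLedger : D.UnderHypotheses Hβ fun g₀ => ∀ os : List (ULoop F),
      LedgerAt (L g₀ os) (l₀ g₀ os) (vol g₀ os) (T g₀ os) (Bad g₀ os)
        (fun K t τ => A g₀ os K t τ - shA g₀ os K t τ) (fun K t τ => B g₀ os K t τ - shB g₀ os K t τ)
        R EA EB κ (g g₀ os) uA uB ω θc θ₅ θ₃) :
    D.UnderHypotheses Hβ fun g₀ => ∀ os : List (ULoop F),
      ∃ (σ : Type) (_ : DecidableEq σ) (L : LedgerData C ι σ) (l₀ vol : ℝ) (K₀ : ℕ) (T : ℕ → Finset σ)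
        (Bad : ℕ → ℝ → Finset σ) (A B shA shB : ℕ → ℝ → σ → ℝ) (W Wsh : ℕ → ℝ),
        0 < l₀ ∧ 0 < vol ∧ RelWeightBound l₀ T A B Bad W ∧ ShellWeightBound l₀ T A B shA shB Wsh ∧ (∀ K, W K + Wsh K < 1) ∧
        (∀ (K : ℕ) (t : ℝ), |t| ≤ l₀ → T4GenFunBounds.schemeZ (D.scheme g₀) os (K₀ + K) t = ∑ τ ∈ T K, A K t τ) ∧
        (∀ (K : ℕ) (t : ℝ), |t| ≤ l₀ → T4GenFunBounds.schemeZ (D.scheme g₀) os (K₀ + K + 1) t = ∑ τ ∈ T K, B K t τ) ∧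
        PolyLipGrowth CU (fun K => extd (prefixOf (runFlow D g₀ (K₀ + K)) (K₀ + K))) P q ∧
        LedgerAt L l₀ vol T Bad (fun K t τ => A K t τ - shA K t τ) (fun K t τ => B K t τ - shB K t τ) R EA EB κ
          (fun K => extd (prefixOf (runFlow D g₀ (K₀ + K)) (K₀ + K))) uA uB ω θc θ₅ θ₃ := by
  intro hB hβ
  have H2 : ForSmallCouplings D _ := hK5 hB hβ
  have H3 : ForSmallCouplings D _ := hG hB hβ
  have H4 : ForSmallCouplings D _ := hLedger hB hβ
  refine ((H2.and H3).and H4).mono fun g₀ h os => ?_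
  obtain ⟨⟨hk5, hGg⟩, hledger⟩ := h
  obtain ⟨hl₀, hvol, h20, h21, hlt, hE1, hE2⟩ := hk5 os
  have e : g g₀ os = fun K => extd (prefixOf (runFlow D g₀ (K₀ g₀ os + K)) (K₀ g₀ os + K)) := funext (hg g₀ os)
  exact ⟨σ, ‹_›, L g₀ os, l₀ g₀ os, vol g₀ os, K₀ g₀ os, T g₀ os, Bad g₀ os, A g₀ os, B g₀ os, shA g₀ os, shB g₀ os, W g₀ os,
    Wsh g₀ os, hl₀, hvol, h20, h21, hlt, hE1, hE2, e ▸ hGg os, e ▸ hledger os⟩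

end Datum

end Summit.QuantumFields.YangMills.Theorems.BalabanUVNodesN27SpineRecord
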